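/-
Copyright (c) 2026 the pub-hodgecm-mathlib formalisation cell (harness21).  Prover seat hodgecm-mathlib-K2E1-p11 (g6), Track B ∕ K2-LIT, h413 = `stmt-HodgeConjecture-24833`,
R90-TF section S8 «ContSpec-n½», the `hsrc` supplier estate, RULING J-S8-ω (S8 dealer R90-CS-plan (g4), S8-R313 (c)), FILE (γ): THE TOKENS OF THE DESCRIPTIVE WEIGHT — at a GOOD
place `v` (`|𝔫|_w = 1`, translate `k_f` integral at `v`) the descriptive weight `ω^{(k)}_v` (★ FILE (α)) drops `k_f` and COINCIDES with the explicit weights of ★ p865184 (inert) ∕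
★ p865482 (split) through the shared Iwasawa decomposition; hence ★ p865409's rows `hin hsp hω1` (and ★ p864821's) hold for it, for every such `k_f`.
-/
import Summits.HodgeConjecture.HodgeConjecture.Theorems.K2E1ChiDescriptiveWeightContinuityU3   -- ★ p865561 (this seat, FILE (β)); brings ★ FILE (α) `exists_finiteAdele_apply_eq`, `apply_inclPlace_eq_prod_of_eq_mul`
import Summits.HodgeConjecture.HodgeConjecture.Theorems.K2E1ChiGoodSplitWeightU3               -- ★ p865482 (this seat): `exists_goodSplit_weight`; brings ★ p865184 `exists_goodInert_weight`, ★ `chiLocalMean_eq_inertToken_of_torusEntry`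
import Summits.HodgeConjecture.HodgeConjecture.Theorems.K2E1IntertwiningLocalMeanCMU3           -- ★ (K2E2-p12): `localHeight_eq_one_of_mem_integralBox` (`Q_v = 1` on `𝒪_v³` at a good place)
import HarnessLib

/-!
# K2·E1 ∕ R90·S8 — `K2E1ChiDescriptiveWeightTokensU3` (RULING J-S8-ω, FILE (γ)): THE DESCRIPTIVE WEIGHT AT A GOOD PLACE IS THE EXPLICIT WEIGHT — rows `hin hsp hω1` for every
# finite translate integral at `v`

Cell `pub/hodgecm-mathlib`, crux h413 = `stmt-HodgeConjecture-24833`, route of record `HCCMUnconditional`; R90-TF section S8 «ContSpec-n½», (V-1) rows `hunfK` (★ p865409) and `hsrc`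
(★ p864821), their common weight `ω` (J-S8-ω).  THEOREMS ONLY (no `def`, no `instance`, no `notation`, no named-fact hypothesis, no `sorry`; default heartbeats); lane
`--supports stmt-HodgeConjecture-24833 --as helper` (count-neutral).  Closes no socket.

THE MATHEMATICS ([PlatonovRapinchuk1994] §5.1; [BorelJacquet1979] §4.1; [Rogawski1990] §4.5 p. 45, §13.9 p. 229; [Langlands1971] §3; [Casselman1980] §3).  Let `Φf` satisfy the finite-level law
at `(χ, 1, K_f(𝔫))` and be right-`K_f(𝔫)`-invariant, `v` a finite place of `L⁺` with `|𝔫|_w = 1` for every `w ∣ v`, and `k_f` a finite translate whose `v`-component lies in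
`K_v(𝔫) = ∏_{w∣v} K_w(1)` (e.g. `ι_f k_f ∈ K_max`).  (1) REDUCTION: `ι^{(v)}((ι(w₀)·n(x)·k_f)_v) = ι^{(v)}((ι(w₀)·n(x))_v)·ι^{(v)}((k_f)_v)` with `ι^{(v)}((k_f)_v) ∈ K_f(𝔫)`, so
`ω^{(k)}_v(x|_v) = Φf(ι^{(v)}((ι(w₀)·n(x))_v))` — the translate drops out at good places.  (2) IDENTIFICATION: if `(ι(w₀)·n(x))_v = β·κ` is ANY Iwasawa decomposition (β upper triangular,
`κ_w ∈ K_w(|𝔫|_w)`) with local units `t_w = (β_w)₀₀`, then `ω^{(k)}_v(x|_v) = ∏_{w∣v} χ_w(t_w)` (★ FILE (α) `apply_inclPlace_eq_prod_of_eq_mul`) — the SAME decomposition the explicit weights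
of ★ p865184 (inert, clause (ii)) and ★ p865482 (split, clause (ii)) read at the base point `1`; since every `p` is some `x|_v`, **`ω^{(k)}_v = ω^{inert}_v`, resp. `= ω^{split}_v`, as
functions**.  (3) Hence their rows transfer verbatim: INERT — the torus-entry letters (★ p865184 (i)) feed ★ `chiLocalMean_eq_inertToken_of_torusEntry`: `ν(𝒪_v³)⁻¹∫ω^{(k)}_v Q_v^{−z} =
(1−e q^{−2z})(1+e q^{−(2z−1)})∕((1−e q^{−(2z−2)})(1+e q^{−(2z−2)}))`, `e = φ(ϖ_w)` (row `hin`), and `ω^{(k)}_v = 1` on `𝒪_v³ ⊆ {Q_v = 1}` (★ `localHeight_eq_one_of_mem_integralBox`, ★ p865184 (iii))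
(row `hω1`); SPLIT — ★ p865482 (i) is the split token for both `w' ∣ v` (row `hsp`) and ★ p865482 (iii) the box (row `hω1`).
* §1 `inclPlace_mem_finCongruenceLevel_of_forall`, **`descriptiveWeight_apply_eq_prod`** (reduction + identification with any Iwasawa reading at the base point `1`).
* §2 HEADS **`descriptiveWeight_rows_inert`** (`hin` ∧ `hω1` at a good inert place) and **`descriptiveWeight_rows_split`** (`hsp` ∧ `hω1` at a good split place), for every `k_f` integral at `v`.
HONEST LABEL: HC_CM is proved only modulo the 7 printed citations (2 remaining named inputs: hLiu418 = `stmt-HodgeConjecture-24832`, h413 = `stmt-HodgeConjecture-24833`) until rung 0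
closes; REL ≠ ★ ≠ BUILT; unconditional; asserts no named fact, closes no socket; FILE (γ) of five; count-neutral.

## References
* [PlatonovRapinchuk1994] V. Platonov, A. Rapinchuk, *Algebraic Groups and Number Theory* (1994), §5.1.
* [BorelJacquet1979] A. Borel, H. Jacquet, *Automorphic forms and automorphic representations*, PSPM 33.1 (1979), §4.1.
* [Rogawski1990] J. D. Rogawski, *Automorphic Representations of Unitary Groups in Three Variables*, Ann. of Math. Stud. 123 (1990), §4.5 p. 45, §13.9 p. 229.
* [Langlands1971] R. P. Langlands, *Euler Products* (1971), §3.
* [Casselman1980] W. Casselman, *The unramified principal series of p-adic groups I*, Compositio Math. 40 (1980), §3.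
-/

set_option autoImplicit false
set_option linter.dupNamespace false  -- the mandated namespace repeats the summit's segment (`HodgeConjecture.HodgeConjecture`)

noncomputable section

open MeasureTheory NumberField IsDedekindDomain Filter Set Function
open scoped NNReal
open Literature.NumberTheory.GaloisRepresentations Literature.NumberTheory.GaloisRepresentations.HeckeCharacter
open Literature.NumberTheory.GaloisRepresentations.IsNonarchimedeanLocalField
open Literature.NumberTheory.Automorphic Literature.NumberTheory.Automorphic.UnitaryGroup AdelicGroupData
open Literature.NumberTheory.Automorphic.Arthur2013.Leaves.TECR
open Summit.HodgeConjecture.HodgeConjecture.Cruxes.H413.K2E1CharacterEisensteinU2Defs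
open Summit.HodgeConjecture.HodgeConjecture.Cruxes.H413.K2E1CharacterEisensteinU3PairDefs
open Summit.HodgeConjecture.HodgeConjecture.Cruxes.H413.K2E1ChiMidBlockUnfoldingLetterFreeU3 (apply_diag_ne_zero_of_blockTriangular)
open Summit.HodgeConjecture.HodgeConjecture.Cruxes.H413.K2E1FinAdelicBorelLevelLocalGlobalU3 (mem_finCongruenceLevel_iff_forall_evalPlace)
open Summit.HodgeConjecture.HodgeConjecture.Cruxes.H413.K2E1ChiDescriptiveWeightU3 (exists_finiteAdele_apply_eq apply_inclPlace_eq_prod_of_eq_mul)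
open Summit.HodgeConjecture.HodgeConjecture.Cruxes.H413.K2E1ChiGoodInertReadingU3 (exists_goodInert_weight)
open Summit.HodgeConjecture.HodgeConjecture.Cruxes.H413.K2E1ChiGoodSplitWeightU3 (exists_goodSplit_weight)
open Summit.HodgeConjecture.HodgeConjecture.Cruxes.H413.K2E1ChiLocalMeansOfShellU3 (chiLocalMean_eq_inertToken_of_torusEntry)
open Summit.HodgeConjecture.HodgeConjecture.Cruxes.H413.K2E1IntertwiningLocalMeanCMU3 (localHeight_eq_one_of_mem_integralBox)

namespace Summit.HodgeConjecture.HodgeConjecture.Cruxes.H413.K2E1ChiDescriptiveWeightTokensU3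

variable (L : Type) [Field L] [NumberField L] [IsCMField L] (hc : IsCMField.complexConj L * IsCMField.complexConj L = 1)
  {δ : L} (hcδ : IsCMField.complexConj L δ = -δ) (hδ : δ ≠ 0) {d : ↥(maximalRealSubfield L)} (hd : δ * δ = algebraMap ↥(maximalRealSubfield L) L d)
  (v : HeightOneSpectrum (𝓞 ↥(maximalRealSubfield L)))

/-! ## §1 Reduction of the translate and identification with any Iwasawa reading at the base point `1` -/

/-- `ι^{(v)}(κ) ∈ K_f(𝔫)` when `κ_w ∈ K_w(|𝔫|_w)` for every `w ∣ v` (the other components are `1`). [cite: PlatonovRapinchuk1994, §5.1] -/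
theorem inclPlace_mem_finCongruenceLevel_of_forall (𝔫 : Ideal (𝓞 L)) {κ : localPi L (IsCMField.complexConj L) 3 ((StdForm.antidiagonal 3).over L) v}
    (hκ : ∀ w : PlacesOver L v, ((κ : localPi L (IsCMField.complexConj L) 3 ((StdForm.antidiagonal 3).over L) v) : LocalGLPi L 3 v) w ∈ valuedCongruenceSubgroup (Fin 3) (idealRadius L w.1 𝔫)) :
    inclPlace (↥(maximalRealSubfield L)) L (IsCMField.complexConj L) 3 ((StdForm.antidiagonal 3).over L) v κ ∈
      finCongruenceLevel (↥(maximalRealSubfield L)) L (IsCMField.complexConj L) 3 ((StdForm.antidiagonal 3).over L) 𝔫 := by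
  classical
  rw [mem_finCongruenceLevel_iff_forall_evalPlace]
  intro v' w
  by_cases h : v' = v
  · subst h
    rw [evalPlace_inclPlace]
    exact hκ w
  · rw [evalPlace_inclPlace_of_ne (↥(maximalRealSubfield L)) L (IsCMField.complexConj L) 3 _ h, OneMemClass.coe_one, Pi.one_apply]
    exact one_mem _

/-- **REDUCTION + IDENTIFICATION.**  `Φf` with the (supp-on) law at `(χ, 1, K_f(𝔫))`, right-`K_f(𝔫)`-invariant; `k_f` with `(k_f)_v ∈ K_v(𝔫)`; `ω_v` with FILE (α)'s defining equation at `k_f`.  If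
`(ι(w₀)·n(x))_v·1 = β·κ` is an Iwasawa decomposition with local units `t_w = (β_w)₀₀`, then **`ω_v(x|_v) = ∏_{w∣v} χ_w(t_w)`** — the translate drops (`ι^{(v)}((k_f)_v) ∈ K_f(𝔫)`) and ★ FILE (α)
`apply_inclPlace_eq_prod_of_eq_mul` reads the rest. [cite: PlatonovRapinchuk1994, §5.1] [cite: BorelJacquet1979, §4.1] [cite: Rogawski1990, §4.5 p. 45] -/
theorem descriptiveWeight_apply_eq_prod (χ : HeckeCharacter L) (𝔫 : Ideal (𝓞 L))
    (Φf : ↥(finAdelic (↥(maximalRealSubfield L)) L (IsCMField.complexConj L) 3 ((StdForm.antidiagonal 3).over L)) → ℂ)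
    (hon : ∀ (b k : ↥(finAdelic (↥(maximalRealSubfield L)) L (IsCMField.complexConj L) 3 ((StdForm.antidiagonal 3).over L)))
        (hb : finAdelicToAdelic (↥(maximalRealSubfield L)) L (IsCMField.complexConj L) 3 ((StdForm.antidiagonal 3).over L) b ∈ borelAdelic (↥(maximalRealSubfield L)) L (IsCMField.complexConj L) 3),
        k ∈ finCongruenceLevel (↥(maximalRealSubfield L)) L (IsCMField.complexConj L) 3 ((StdForm.antidiagonal 3).over L) 𝔫 →
        Φf (b * k) = ((χ (firstEntryUnit hb) : ℂˣ) : ℂ) * (((1 : ↥(TorusDict.torus (IsCMField.complexConj L)) →ₜ* ℂˣ) (middleEntryUnitary hb) : ℂˣ) : ℂ))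
    (hK : ∀ u, ∀ k ∈ finCongruenceLevel (↥(maximalRealSubfield L)) L (IsCMField.complexConj L) 3 ((StdForm.antidiagonal 3).over L) 𝔫, Φf (u * k) = Φf u)
    (kf : ↥(finAdelic (↥(maximalRealSubfield L)) L (IsCMField.complexConj L) 3 ((StdForm.antidiagonal 3).over L)))
    (hkf : ∀ w : PlacesOver L v, ((evalPlace (↥(maximalRealSubfield L)) L (IsCMField.complexConj L) 3 ((StdForm.antidiagonal 3).over L) v kf :
      localPi L (IsCMField.complexConj L) 3 ((StdForm.antidiagonal 3).over L) v) : LocalGLPi L 3 v) w ∈ valuedCongruenceSubgroup (Fin 3) (idealRadius L w.1 𝔫))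
    (ω : (Fin 3 → v.adicCompletion ↥(maximalRealSubfield L)) → ℂ)
    (hω : ∀ x : Fin 3 → FiniteAdeleRing (𝓞 ↥(maximalRealSubfield L)) ↥(maximalRealSubfield L),
      ω (fun i => x i v) = Φf (inclPlace (↥(maximalRealSubfield L)) L (IsCMField.complexConj L) 3 ((StdForm.antidiagonal 3).over L) v
        (evalPlace (↥(maximalRealSubfield L)) L (IsCMField.complexConj L) 3 ((StdForm.antidiagonal 3).over L) v
          (finPart (↥(maximalRealSubfield L)) L (IsCMField.complexConj L) 3 ((StdForm.antidiagonal 3).over L)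
            ((quasiSplit (↥(maximalRealSubfield L)) L (IsCMField.complexConj L) 3).toAdelic (weylLongU ((IsCMField.complexConj L : L ≃ₐ[↥(maximalRealSubfield L)] L) : L →+* L) (rfl : (StdForm.antidiagonal 3).over L = (StdForm.antidiagonal 3).over L)) *
              ((heisChart hc (((((0 : InfiniteAdeleRing L)), quadraticFiniteAdeleMap ↥(maximalRealSubfield L) L δ (x 0, x 1)) : AdeleRing (𝓞 L) L),
                traceZeroLine ↥(maximalRealSubfield L) L (IsCMField.complexConj L) hcδ hδ ((0, x 2) : AdeleRing (𝓞 ↥(maximalRealSubfield L)) ↥(maximalRealSubfield L))) :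
                  ↥(adelicUnipotent ↥(maximalRealSubfield L) L (IsCMField.complexConj L) 3)) : (quasiSplit (↥(maximalRealSubfield L)) L (IsCMField.complexConj L) 3).Adelic)) * kf))))
    (x : Fin 3 → FiniteAdeleRing (𝓞 ↥(maximalRealSubfield L)) ↥(maximalRealSubfield L))
    (β κ : localPi L (IsCMField.complexConj L) 3 ((StdForm.antidiagonal 3).over L) v)
    (hβ : ∀ w : PlacesOver L v, ((((β : localPi L (IsCMField.complexConj L) 3 ((StdForm.antidiagonal 3).over L) v) : LocalGLPi L 3 v) w : GL (Fin 3) (w.1.adicCompletion L)) :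
      Matrix (Fin 3) (Fin 3) (w.1.adicCompletion L)).BlockTriangular id)
    (hκ : ∀ w : PlacesOver L v, ((κ : localPi L (IsCMField.complexConj L) 3 ((StdForm.antidiagonal 3).over L) v) : LocalGLPi L 3 v) w ∈ valuedCongruenceSubgroup (Fin 3) (idealRadius L w.1 𝔫))
    (hprod : evalPlace (↥(maximalRealSubfield L)) L (IsCMField.complexConj L) 3 ((StdForm.antidiagonal 3).over L) v
        (finPart (↥(maximalRealSubfield L)) L (IsCMField.complexConj L) 3 ((StdForm.antidiagonal 3).over L)
          ((quasiSplit (↥(maximalRealSubfield L)) L (IsCMField.complexConj L) 3).toAdelic (weylLongU ((IsCMField.complexConj L : L ≃ₐ[↥(maximalRealSubfield L)] L) : L →+* L) (rfl : (StdForm.antidiagonal 3).over L = (StdForm.antidiagonal 3).over L)) *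
            ((heisChart hc (((((0 : InfiniteAdeleRing L)), quadraticFiniteAdeleMap ↥(maximalRealSubfield L) L δ (x 0, x 1)) : AdeleRing (𝓞 L) L),
              traceZeroLine ↥(maximalRealSubfield L) L (IsCMField.complexConj L) hcδ hδ ((0, x 2) : AdeleRing (𝓞 ↥(maximalRealSubfield L)) ↥(maximalRealSubfield L))) :
                ↥(adelicUnipotent ↥(maximalRealSubfield L) L (IsCMField.complexConj L) 3)) : (quasiSplit (↥(maximalRealSubfield L)) L (IsCMField.complexConj L) 3).Adelic)) * 1) = β * κ)
    (t : ∀ w : PlacesOver L v, (w.1.adicCompletion L)ˣ)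
    (ht : ∀ w : PlacesOver L v, ((t w : (w.1.adicCompletion L)ˣ) : w.1.adicCompletion L) =
      ((((β : localPi L (IsCMField.complexConj L) 3 ((StdForm.antidiagonal 3).over L) v) : LocalGLPi L 3 v) w : GL (Fin 3) (w.1.adicCompletion L)) : Matrix (Fin 3) (Fin 3) (w.1.adicCompletion L)) 0 0) :
    ω (fun i => x i v) = ∏ w : PlacesOver L v, ((χ.localComponent w.1 (t w) : ℂˣ) : ℂ) := by
  rw [mul_one] at hprod
  rw [hω, map_mul, map_mul, hK _ _ (inclPlace_mem_finCongruenceLevel_of_forall L v 𝔫 hkf), hprod,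
    apply_inclPlace_eq_prod_of_eq_mul L χ 𝔫 Φf v hon β κ hβ hκ rfl (fun w => Units.mk0 _ (apply_diag_ne_zero_of_blockTriangular (hβ w) 0)) (fun w => rfl)]
  exact Finset.prod_congr rfl fun w _ => by rw [show Units.mk0 _ (apply_diag_ne_zero_of_blockTriangular (hβ w) 0) = t w from Units.ext (ht w).symm]

/-- The base point `1` has all components `1`. [folklore] -/
theorem coe_evalPlace_one_apply (w : PlacesOver L v) :
    ((((evalPlace (↥(maximalRealSubfield L)) L (IsCMField.complexConj L) 3 ((StdForm.antidiagonal 3).over L) v 1 : localPi L (IsCMField.complexConj L) 3 ((StdForm.antidiagonal 3).over L) v) : LocalGLPi L 3 v) w :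
      GL (Fin 3) (w.1.adicCompletion L)) : Matrix (Fin 3) (Fin 3) (w.1.adicCompletion L)) = 1 := by
  rw [map_one, OneMemClass.coe_one, Pi.one_apply, Units.val_one]

/-! ## §2 HEADS: the rows `hin hsp hω1` of the descriptive weight at a good place -/

section Rows

variable [MeasurableSpace (v.adicCompletion ↥(maximalRealSubfield L))] [BorelSpace (v.adicCompletion ↥(maximalRealSubfield L))]
  (ν : Measure (v.adicCompletion ↥(maximalRealSubfield L))) [ν.IsAddHaarMeasure]

include hd in
/-- **HEAD (INERT) — rows `hin` and `hω1` of the descriptive weight at a GOOD INERT place.**  `v` unramified in `L` and non-split (`c·w = w`), `|2|_v = 1`, `|δ|_w = 1`, `φ` unitary and unramified at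
`w`, `|𝔫|_{w'} = 1`, `(k_f)_v ∈ K_v(𝔫)`; `ω_v` with FILE (α)'s defining equation.  THEN `ω_v` equals ★ p865184's explicit weight (§1 identification), so: for `1 < Re z`,
`ν(𝒪_v³)⁻¹∫ω_v·Q_v^{−z} = (1−e q_v^{−2z})(1+e q_v^{−(2z−1)})∕((1−e q_v^{−(2z−2)})(1+e q_v^{−(2z−2)}))`, `e = φ(ϖ_w)` (★ `chiLocalMean_eq_inertToken_of_torusEntry` on ★ p865184 (i)), and `ω_v = 1` on `𝒪_v³`
(★ `localHeight_eq_one_of_mem_integralBox`, ★ p865184 (iii)). [cite: Rogawski1990, §13.9 p. 229] [cite: Casselman1980, §3] [cite: Langlands1971, §3] [cite: PlatonovRapinchuk1994, §5.1] -/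
theorem descriptiveWeight_rows_inert {φ : HeckeCharacter L} (hφ : φ.IsUnitary) (𝔫 : Ideal (𝓞 L))
    (Φf : ↥(finAdelic (↥(maximalRealSubfield L)) L (IsCMField.complexConj L) 3 ((StdForm.antidiagonal 3).over L)) → ℂ)
    (hon : ∀ (b k : ↥(finAdelic (↥(maximalRealSubfield L)) L (IsCMField.complexConj L) 3 ((StdForm.antidiagonal 3).over L)))
        (hb : finAdelicToAdelic (↥(maximalRealSubfield L)) L (IsCMField.complexConj L) 3 ((StdForm.antidiagonal 3).over L) b ∈ borelAdelic (↥(maximalRealSubfield L)) L (IsCMField.complexConj L) 3),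
        k ∈ finCongruenceLevel (↥(maximalRealSubfield L)) L (IsCMField.complexConj L) 3 ((StdForm.antidiagonal 3).over L) 𝔫 →
        Φf (b * k) = ((φ (firstEntryUnit hb) : ℂˣ) : ℂ) * (((1 : ↥(TorusDict.torus (IsCMField.complexConj L)) →ₜ* ℂˣ) (middleEntryUnitary hb) : ℂˣ) : ℂ))
    (hK : ∀ u, ∀ k ∈ finCongruenceLevel (↥(maximalRealSubfield L)) L (IsCMField.complexConj L) 3 ((StdForm.antidiagonal 3).over L) 𝔫, Φf (u * k) = Φf u)
    (w : PlacesOver L v) (hunr : Algebra.IsUnramifiedIn (𝓞 L) v.asIdeal) (hw : IsCMField.complexConj L • w.1 = w.1)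
    (h2 : Valued.v (2 : v.adicCompletion ↥(maximalRealSubfield L)) = 1) (hδu : ∀ w' : PlacesOver L v, Valued.v (algebraMap L (LocalRing L v) δ w') = 1) (hur : φ.IsUnramifiedAt w.1)
    (h𝔫 : ∀ w' : PlacesOver L v, idealRadius L w'.1 𝔫 = 1)
    (kf : ↥(finAdelic (↥(maximalRealSubfield L)) L (IsCMField.complexConj L) 3 ((StdForm.antidiagonal 3).over L)))
    (hkf : ∀ w' : PlacesOver L v, ((evalPlace (↥(maximalRealSubfield L)) L (IsCMField.complexConj L) 3 ((StdForm.antidiagonal 3).over L) v kf :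
      localPi L (IsCMField.complexConj L) 3 ((StdForm.antidiagonal 3).over L) v) : LocalGLPi L 3 v) w' ∈ valuedCongruenceSubgroup (Fin 3) (idealRadius L w'.1 𝔫))
    (ω : (Fin 3 → v.adicCompletion ↥(maximalRealSubfield L)) → ℂ)
    (hω : ∀ x : Fin 3 → FiniteAdeleRing (𝓞 ↥(maximalRealSubfield L)) ↥(maximalRealSubfield L),
      ω (fun i => x i v) = Φf (inclPlace (↥(maximalRealSubfield L)) L (IsCMField.complexConj L) 3 ((StdForm.antidiagonal 3).over L) v
        (evalPlace (↥(maximalRealSubfield L)) L (IsCMField.complexConj L) 3 ((StdForm.antidiagonal 3).over L) v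
          (finPart (↥(maximalRealSubfield L)) L (IsCMField.complexConj L) 3 ((StdForm.antidiagonal 3).over L)
            ((quasiSplit (↥(maximalRealSubfield L)) L (IsCMField.complexConj L) 3).toAdelic (weylLongU ((IsCMField.complexConj L : L ≃ₐ[↥(maximalRealSubfield L)] L) : L →+* L) (rfl : (StdForm.antidiagonal 3).over L = (StdForm.antidiagonal 3).over L)) *
              ((heisChart hc (((((0 : InfiniteAdeleRing L)), quadraticFiniteAdeleMap ↥(maximalRealSubfield L) L δ (x 0, x 1)) : AdeleRing (𝓞 L) L),
                traceZeroLine ↥(maximalRealSubfield L) L (IsCMField.complexConj L) hcδ hδ ((0, x 2) : AdeleRing (𝓞 ↥(maximalRealSubfield L)) ↥(maximalRealSubfield L))) :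
                  ↥(adelicUnipotent ↥(maximalRealSubfield L) L (IsCMField.complexConj L) 3)) : (quasiSplit (↥(maximalRealSubfield L)) L (IsCMField.complexConj L) 3).Adelic)) * kf)))) :
    (∀ z : ℂ, 1 < z.re →
      ((Measure.pi fun _ : Fin 3 => ν) (integralBox ↥(maximalRealSubfield L) (Fin 3) v)).toReal⁻¹ •
          ∫ p : Fin 3 → v.adicCompletion ↥(maximalRealSubfield L),
            ω p * (((∏ w' : PlacesOver L v, max 1 (max ((normAbs (w'.1.adicCompletion L) (quadraticLocalEquiv L v (IsCMField.complexConj L) hcδ hδ (p 0, p 1) w') : ℝ≥0) : ℝ)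
              ((normAbs (w'.1.adicCompletion L) ((toLocalRing L v (p 2) * algebraMap L (LocalRing L v) δ -
                toLocalRing L v 2⁻¹ * (quadraticLocalEquiv L v (IsCMField.complexConj L) hcδ hδ (p 0, p 1) *
                  conjLocal L (IsCMField.complexConj L) v (quadraticLocalEquiv L v (IsCMField.complexConj L) hcδ hδ (p 0, p 1)))) w') : ℝ≥0) : ℝ))) : ℝ) : ℂ) ^ (-z)
            ∂(Measure.pi fun _ : Fin 3 => ν) =
        (1 - φ.valueAtUniformizer w.1 * (v.residueCard : ℂ) ^ (-(2 * z))) * (1 + φ.valueAtUniformizer w.1 * (v.residueCard : ℂ) ^ (-(2 * z - 1))) /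
          ((1 - φ.valueAtUniformizer w.1 * (v.residueCard : ℂ) ^ (-(2 * z - 2))) * (1 + φ.valueAtUniformizer w.1 * (v.residueCard : ℂ) ^ (-(2 * z - 2))))) ∧
    (∀ p ∈ integralBox ↥(maximalRealSubfield L) (Fin 3) v, ω p = 1) := by
  -- ★ p865184's explicit weight at the base point `1`, and the identification `ω = ωv`
  obtain ⟨ωv, ⟨α, hα, hω1', hωQ'⟩, hread, hone⟩ := exists_goodInert_weight L hc hcδ hδ hd v φ 𝔫 w hunr hw h2 (hδu w) h𝔫 1 (coe_evalPlace_one_apply L v)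
  have heq : ∀ p, ω p = ωv p := fun p => by
    obtain ⟨x, hx⟩ := exists_finiteAdele_apply_eq L v p
    have hxv : (fun i => x i v) = p := funext hx
    obtain ⟨β, κ, t, hβ, hκ, hprod, ht, hval⟩ := hread x
    rw [← hxv, hval]
    exact descriptiveWeight_apply_eq_prod L hc hcδ hδ v φ 𝔫 Φf hon hK kf hkf ω hω x β κ hβ hκ hprod t ht
  refine ⟨fun z hz => ?_, fun p hp => ?_⟩
  · exact chiLocalMean_eq_inertToken_of_torusEntry L hcδ hδ hd v ν hunr w hw h2 (hδu w) hφ hur α hα ω (fun p hp => by rw [heq]; exact hω1' p hp)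
      (fun p hp => by rw [heq]; exact hωQ' p hp) hz
  · rw [heq]
    exact hone p (localHeight_eq_one_of_mem_integralBox L hcδ hδ hd v hunr h2 hδu hp)

include hd in
/-- **HEAD (SPLIT) — rows `hsp` and `hω1` of the descriptive weight at a GOOD SPLIT place.**  `w ∣ v` with `c·w ≠ w`, `|2|_v = 1`, `|δ|_{w'} = 1`, `φ` unitary, unramified at every `w' ∣ v`,
`|𝔫|_{w'} = 1`, `(k_f)_v ∈ K_v(𝔫)`; `ω_v` with FILE (α)'s defining equation.  THEN `ω_v` equals ★ p865482's explicit weight (§1 identification), so ★ p865482 (i) — the split token at every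
`w' ∣ v`, `1 < Re z` — and (iii) — `ω_v = 1` on `𝒪_v³` — hold for `ω_v`. [cite: Langlands1971, §3] [cite: Rogawski1990, §13.9 p. 229] [cite: PlatonovRapinchuk1994, §5.1] -/
theorem descriptiveWeight_rows_split {φ : HeckeCharacter L} (hφ : φ.IsUnitary) (𝔫 : Ideal (𝓞 L))
    (Φf : ↥(finAdelic (↥(maximalRealSubfield L)) L (IsCMField.complexConj L) 3 ((StdForm.antidiagonal 3).over L)) → ℂ)
    (hon : ∀ (b k : ↥(finAdelic (↥(maximalRealSubfield L)) L (IsCMField.complexConj L) 3 ((StdForm.antidiagonal 3).over L)))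
        (hb : finAdelicToAdelic (↥(maximalRealSubfield L)) L (IsCMField.complexConj L) 3 ((StdForm.antidiagonal 3).over L) b ∈ borelAdelic (↥(maximalRealSubfield L)) L (IsCMField.complexConj L) 3),
        k ∈ finCongruenceLevel (↥(maximalRealSubfield L)) L (IsCMField.complexConj L) 3 ((StdForm.antidiagonal 3).over L) 𝔫 →
        Φf (b * k) = ((φ (firstEntryUnit hb) : ℂˣ) : ℂ) * (((1 : ↥(TorusDict.torus (IsCMField.complexConj L)) →ₜ* ℂˣ) (middleEntryUnitary hb) : ℂˣ) : ℂ))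
    (hK : ∀ u, ∀ k ∈ finCongruenceLevel (↥(maximalRealSubfield L)) L (IsCMField.complexConj L) 3 ((StdForm.antidiagonal 3).over L) 𝔫, Φf (u * k) = Φf u)
    (w : PlacesOver L v) (hw : IsCMField.complexConj L • w.1 ≠ w.1)
    (h2 : Valued.v (2 : v.adicCompletion ↥(maximalRealSubfield L)) = 1) (hδu : ∀ w' : PlacesOver L v, Valued.v (algebraMap L (LocalRing L v) δ w') = 1)
    (hur : ∀ w' : PlacesOver L v, φ.IsUnramifiedAt w'.1) (h𝔫 : ∀ w' : PlacesOver L v, idealRadius L w'.1 𝔫 = 1)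
    (kf : ↥(finAdelic (↥(maximalRealSubfield L)) L (IsCMField.complexConj L) 3 ((StdForm.antidiagonal 3).over L)))
    (hkf : ∀ w' : PlacesOver L v, ((evalPlace (↥(maximalRealSubfield L)) L (IsCMField.complexConj L) 3 ((StdForm.antidiagonal 3).over L) v kf :
      localPi L (IsCMField.complexConj L) 3 ((StdForm.antidiagonal 3).over L) v) : LocalGLPi L 3 v) w' ∈ valuedCongruenceSubgroup (Fin 3) (idealRadius L w'.1 𝔫))
    (ω : (Fin 3 → v.adicCompletion ↥(maximalRealSubfield L)) → ℂ)
    (hω : ∀ x : Fin 3 → FiniteAdeleRing (𝓞 ↥(maximalRealSubfield L)) ↥(maximalRealSubfield L),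
      ω (fun i => x i v) = Φf (inclPlace (↥(maximalRealSubfield L)) L (IsCMField.complexConj L) 3 ((StdForm.antidiagonal 3).over L) v
        (evalPlace (↥(maximalRealSubfield L)) L (IsCMField.complexConj L) 3 ((StdForm.antidiagonal 3).over L) v
          (finPart (↥(maximalRealSubfield L)) L (IsCMField.complexConj L) 3 ((StdForm.antidiagonal 3).over L)
            ((quasiSplit (↥(maximalRealSubfield L)) L (IsCMField.complexConj L) 3).toAdelic (weylLongU ((IsCMField.complexConj L : L ≃ₐ[↥(maximalRealSubfield L)] L) : L →+* L) (rfl : (StdForm.antidiagonal 3).over L = (StdForm.antidiagonal 3).over L)) *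
              ((heisChart hc (((((0 : InfiniteAdeleRing L)), quadraticFiniteAdeleMap ↥(maximalRealSubfield L) L δ (x 0, x 1)) : AdeleRing (𝓞 L) L),
                traceZeroLine ↥(maximalRealSubfield L) L (IsCMField.complexConj L) hcδ hδ ((0, x 2) : AdeleRing (𝓞 ↥(maximalRealSubfield L)) ↥(maximalRealSubfield L))) :
                  ↥(adelicUnipotent ↥(maximalRealSubfield L) L (IsCMField.complexConj L) 3)) : (quasiSplit (↥(maximalRealSubfield L)) L (IsCMField.complexConj L) 3).Adelic)) * kf)))) :
    (∀ z : ℂ, 1 < z.re → ∀ w' : PlacesOver L v, IsCMField.complexConj L • w'.1 ≠ w'.1 →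
      ((Measure.pi fun _ : Fin 3 => ν) (integralBox ↥(maximalRealSubfield L) (Fin 3) v)).toReal⁻¹ •
          ∫ p : Fin 3 → v.adicCompletion ↥(maximalRealSubfield L),
            ω p * (((∏ w' : PlacesOver L v, max 1 (max ((normAbs (w'.1.adicCompletion L) (quadraticLocalEquiv L v (IsCMField.complexConj L) hcδ hδ (p 0, p 1) w') : ℝ≥0) : ℝ)
              ((normAbs (w'.1.adicCompletion L) ((toLocalRing L v (p 2) * algebraMap L (LocalRing L v) δ -
                toLocalRing L v 2⁻¹ * (quadraticLocalEquiv L v (IsCMField.complexConj L) hcδ hδ (p 0, p 1) *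
                  conjLocal L (IsCMField.complexConj L) v (quadraticLocalEquiv L v (IsCMField.complexConj L) hcδ hδ (p 0, p 1)))) w') : ℝ≥0) : ℝ))) : ℝ) : ℂ) ^ (-z)
            ∂(Measure.pi fun _ : Fin 3 => ν) =
        (1 - φ.valueAtUniformizer w'.1 * (v.residueCard : ℂ) ^ (-z)) * (1 - φ.valueAtUniformizer (PlacesOver.galInv (IsCMField.complexConj L) w').1 * (v.residueCard : ℂ) ^ (-z)) *
            (1 - φ.valueAtUniformizer w'.1 * φ.valueAtUniformizer (PlacesOver.galInv (IsCMField.complexConj L) w').1 * (v.residueCard : ℂ) ^ (-(2 * z - 1))) /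
          ((1 - φ.valueAtUniformizer w'.1 * (v.residueCard : ℂ) ^ (-(z - 1))) * (1 - φ.valueAtUniformizer (PlacesOver.galInv (IsCMField.complexConj L) w').1 * (v.residueCard : ℂ) ^ (-(z - 1))) *
            (1 - φ.valueAtUniformizer w'.1 * φ.valueAtUniformizer (PlacesOver.galInv (IsCMField.complexConj L) w').1 * (v.residueCard : ℂ) ^ (-(2 * z - 2))))) ∧
    (∀ p ∈ integralBox ↥(maximalRealSubfield L) (Fin 3) v, ω p = 1) := by
  -- ★ p865482's explicit weight at the base point `1`, and the identification `ω = ωv`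
  obtain ⟨ωv, hsp, hread, hbox⟩ := exists_goodSplit_weight L hc hcδ hδ hd v ν hφ 𝔫 w hw h2 hδu hur h𝔫 1 (coe_evalPlace_one_apply L v)
  have heq : ∀ p, ω p = ωv p := fun p => by
    obtain ⟨x, hx⟩ := exists_finiteAdele_apply_eq L v p
    have hxv : (fun i => x i v) = p := funext hx
    obtain ⟨β, κ, t, hβ, hκ, hprod, ht, hval⟩ := hread x
    rw [← hxv, hval]
    exact descriptiveWeight_apply_eq_prod L hc hcδ hδ v φ 𝔫 Φf hon hK kf hkf ω hω x β κ hβ hκ hprod t ht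
  have hfun : ω = ωv := funext heq
  refine ⟨fun z hz w' hw' => ?_, fun p hp => ?_⟩
  · rw [hfun]
    exact hsp z hz w' hw'
  · rw [heq]
    exact hbox p hp

end Rows

end Summit.HodgeConjecture.HodgeConjecture.Cruxes.H413.K2E1ChiDescriptiveWeightTokensU3

end
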